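import Mathlib.RingTheory.AdjoinRoot
import Mathlib.FieldTheory.Finite.GaloisField
import Mathlib.FieldTheory.PrimitiveElement
import Mathlib.Algebra.BigOperators.Fin
import Literature.Computability.MetaComplexity.NWDesignAC0Mod
import HarnessLib

/-!
# NW designs computable in `AC⁰[p]`: the concrete field `𝔽_p[X]/(P)` a machine can recompute

Sequel of `NWDesignAC0Mod.lean` (the polynomial design over an arbitrary field `K ⊇ 𝔽_p` with a
basis, its intersections and its `AC⁰[p]` circuits). The LEARNER of CIKK Thm. 5.1 for `AC⁰[p]`
must COMPUTE the design, so the field, its basis, the evaluation points and the indexing of the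
universe have to be explicit data that a string machine recomputes bit for bit — not a splitting
field with a classically chosen enumeration. This file fixes them (CIKK Thm. 3.6, proof: "such a
field is described by some polynomial over `GF(p)` of degree `O(log_p n)`"):

* `monicOf c` — the monic polynomial `X^t + Σ_{i<t} cᵢ Xⁱ` of a coefficient vector
  (`monic_monicOf`, `natDegree_monicOf`, `exists_eq_monicOf`); `vecIdx` — coefficient vectors
  enumerated by `Fin (p^t)` (least significant digit = `c₀`);
* `exists_irreducible_monicOf` — an irreducible monic of every degree `t ≥ 1` exists (the
  minimal polynomial of a primitive element of `GF(p^t)`); `irredIdx`, **`irredPoly p t`** — the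
  FIRST irreducible monic of degree `t` in the enumeration (`irreducible_irredPoly`, `irredIdx_min`: every
  earlier one is reducible — what a search by trial division finds);
* **`Kt p t = AdjoinRoot (irredPoly p t)`**, a field with the power basis `pbasis` (`t`
  coordinates), `Fintype` of cardinality `p^t` (`card_Kt`), the index `elemIdx : Kt ≃ Fin (p^t)` of
  an element (its coefficient vector as a number) and of a pair `univIdx : Kt × Kt ≃ Fin (p^t·p^t)`;
* the evaluation points `evalPtsC` (the elements of index `0, …, N-1`, `N ≤ p^t`) and **the
  concrete design `designC p t N ℓ : {0,1}^ℓ → (Fin N ↪ Fin (p^t · p^t))`** with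
  `isNWDesign_designC` (intersections `≤ ℓ`) and `acRealOver_designC` (every seed coordinate in
  depth `4`, size `coordSize (p^t) t ℓ p`, over `accBasis p`).

All statements are proved; no named facts are introduced.

## References

* M. Carmosino, R. Impagliazzo, V. Kabanets, A. Kolokolova, *Learning algorithms from natural
  proofs*, CCC 2016, LIPIcs 50, §3.1, Thms. 3.3, 3.6, 3.7 [CarmosinoImpagliazzoKabanetsKolokolova2016].
-/

namespace Literature.Computability.MetaComplexity

open Finset Polynomial Literature.Computability.Complexity

namespace GFDesign

variable (p : ℕ) [hp : Fact p.Prime] {t : ℕ}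

/-! ### Monic polynomials by coefficient vectors -/

/-- The monic polynomial `X^t + Σ_{i<t} cᵢ Xⁱ`. [folklore] -/
noncomputable def monicOf (c : Fin t → ZMod p) : (ZMod p)[X] :=
  X ^ t + ∑ i : Fin t, C (c i) * X ^ (i : ℕ)

/-- The tail has degree `< t`. [folklore] -/
theorem degree_tail_lt (c : Fin t → ZMod p) :
    (∑ i : Fin t, C (c i) * X ^ (i : ℕ)).degree < (t : WithBot ℕ) := by
  refine (degree_sum_le _ _).trans_lt ((Finset.sup_lt_iff (WithBot.bot_lt_coe t)).2 fun i _ => ?_)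
  exact (degree_C_mul_X_pow_le _ _).trans_lt (WithBot.coe_lt_coe.2 i.isLt)

/-- `monicOf c` is monic. [folklore] -/
theorem monic_monicOf (c : Fin t → ZMod p) : (monicOf p c).Monic := by
  rw [monicOf]
  exact (monic_X_pow t).add_of_left (by rw [degree_X_pow]; exact degree_tail_lt p c)

/-- `monicOf c` has degree `t`. [folklore] -/
theorem natDegree_monicOf (c : Fin t → ZMod p) : (monicOf p c).natDegree = t := by
  rw [monicOf, natDegree_add_eq_left_of_degree_lt, natDegree_X_pow]
  rw [degree_X_pow]
  exact degree_tail_lt p c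

/-- The low coefficients of `monicOf c` are `c`. [folklore] -/
theorem coeff_monicOf (c : Fin t → ZMod p) (i : Fin t) : (monicOf p c).coeff i = c i := by
  rw [monicOf, coeff_add, coeff_X_pow, if_neg (Nat.ne_of_lt i.isLt), zero_add, finsetSum_coeff]
  rw [Finset.sum_eq_single i]
  · rw [coeff_C_mul, coeff_X_pow, if_pos rfl, mul_one]
  · intro j _ hj
    rw [coeff_C_mul, coeff_X_pow, if_neg (fun h => hj (Fin.ext h.symm)), mul_zero]
  · intro h; exact absurd (Finset.mem_univ i) h

/-- Every monic polynomial of degree `t` is some `monicOf c`. [folklore] -/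
theorem exists_eq_monicOf {q : (ZMod p)[X]} (hq : q.Monic) (hdeg : q.natDegree = t) :
    ∃ c : Fin t → ZMod p, q = monicOf p c := by
  refine ⟨fun i => q.coeff i, Polynomial.ext fun m => ?_⟩
  rcases lt_trichotomy m t with hm | hm | hm
  · rw [coeff_monicOf p _ ⟨m, hm⟩]
  · have h1 : q.coeff q.natDegree = 1 := hq
    rw [hdeg] at h1
    have h2 : (monicOf p fun i : Fin t => q.coeff i).coeff (monicOf p fun i : Fin t => q.coeff i).natDegree = 1 :=
      monic_monicOf p _
    rw [natDegree_monicOf] at h2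
    rw [hm, h1, h2]
  · rw [coeff_eq_zero_of_natDegree_lt (hdeg ▸ hm), coeff_eq_zero_of_natDegree_lt]
    rwa [natDegree_monicOf]

/-- **An irreducible monic polynomial of every degree `t ≥ 1` over `𝔽_p` exists**: the minimal
polynomial of a primitive element of `GF(p^t)`. [folklore] -/
theorem exists_irreducible_monicOf (ht : t ≠ 0) : ∃ c : Fin t → ZMod p, Irreducible (monicOf p c) := by
  obtain ⟨α, hα⟩ := Field.exists_primitive_element_of_finite_top (ZMod p) (GaloisField p t)
  have hint : IsIntegral (ZMod p) α := IsIntegral.of_finite (ZMod p) α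
  have hdeg : (minpoly (ZMod p) α).natDegree = t := by
    rw [← IntermediateField.adjoin.finrank hint, hα, IntermediateField.finrank_top', GaloisField.finrank p ht]
  obtain ⟨c, hc⟩ := exists_eq_monicOf p (minpoly.monic hint) hdeg
  exact ⟨c, hc ▸ minpoly.irreducible hint⟩

/-! ### The first irreducible monic of degree `t` -/

/-- Coefficient vectors enumerated by `Fin (p^t)`: the vector `c` has index `Σᵢ cᵢ pⁱ` (digits
through `ZMod.finEquiv`). [folklore] -/
noncomputable def vecIdx (t : ℕ) : (Fin t → ZMod p) ≃ Fin (p ^ t) :=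
  (Equiv.arrowCongr (Equiv.refl (Fin t)) (ZMod.finEquiv p).toEquiv.symm).trans finFunctionFinEquiv

/-- Some index carries an irreducible monic. [folklore] -/
theorem exists_irredIdx (ht : t ≠ 0) :
    ∃ m : ℕ, ∃ h : m < p ^ t, Irreducible (monicOf p ((vecIdx p t).symm ⟨m, h⟩)) := by
  obtain ⟨c, hc⟩ := exists_irreducible_monicOf p ht
  exact ⟨vecIdx p t c, (vecIdx p t c).isLt, by simpa using hc⟩

open scoped Classical in
/-- The least index of an irreducible monic of degree `t` (what a search finds first). [folklore] -/
noncomputable def irredIdx (t : ℕ) (ht : t ≠ 0) : ℕ := Nat.find (exists_irredIdx p ht)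

/-- The least index is an index. [folklore] -/
theorem irredIdx_lt (ht : t ≠ 0) : irredIdx p t ht < p ^ t := by
  classical
  obtain ⟨h, -⟩ := Nat.find_spec (exists_irredIdx p ht)
  exact h

/-- **The irreducible polynomial of the construction**: the FIRST irreducible monic of degree `t`
in the enumeration of coefficient vectors (CIKK: "described by some polynomial over `GF(p)` of
degree `O(log_p n)`"). [cite: CarmosinoImpagliazzoKabanetsKolokolova2016, Thm. 3.6 (proof)] -/
noncomputable def irredPoly (t : ℕ) (ht : t ≠ 0) : (ZMod p)[X] :=
  monicOf p ((vecIdx p t).symm ⟨irredIdx p t ht, irredIdx_lt p ht⟩)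

/-- It is irreducible. [folklore] -/
theorem irreducible_irredPoly (ht : t ≠ 0) : Irreducible (irredPoly p t ht) := by
  classical
  obtain ⟨h, hirr⟩ := Nat.find_spec (exists_irredIdx p ht)
  exact hirr

/-- It is monic of degree `t`. [folklore] -/
theorem monic_irredPoly (ht : t ≠ 0) : (irredPoly p t ht).Monic := monic_monicOf p _

/-- Its degree is `t`. [folklore] -/
theorem natDegree_irredPoly (ht : t ≠ 0) : (irredPoly p t ht).natDegree = t := natDegree_monicOf p _

/-- **Minimality**: every monic of smaller index is reducible (so a search by increasing index with
any complete reducibility test returns `irredPoly`). [folklore] -/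
theorem irredIdx_min (ht : t ≠ 0) {m : ℕ} (hm : m < irredIdx p t ht) :
    ¬Irreducible (monicOf p ((vecIdx p t).symm ⟨m, hm.trans (irredIdx_lt p ht)⟩)) := by
  classical
  intro hirr
  exact Nat.find_min (exists_irredIdx p ht) hm ⟨hm.trans (irredIdx_lt p ht), hirr⟩

/-! ### The field `𝔽_p[X]/(P)` -/

/-- The field of the construction: `𝔽_p[X]/(irredPoly p t)`. [cite: CarmosinoImpagliazzoKabanetsKolokolova2016, Thm. 3.6 (proof)] -/
abbrev Kt (p : ℕ) [Fact p.Prime] (t : ℕ) (ht : t ≠ 0) : Type := AdjoinRoot (irredPoly p t ht)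

/-- The defining polynomial is irreducible (instance form). [folklore] -/
instance fact_irreducible_irredPoly (ht : t ≠ 0) : Fact (Irreducible (irredPoly p t ht)) :=
  ⟨irreducible_irredPoly p ht⟩

/-- `Kt` is a field. [folklore] -/
noncomputable instance instFieldKt (ht : t ≠ 0) : Field (Kt p t ht) := AdjoinRoot.instField

/-- **The power basis `1, x, …, x^{t-1}`** of `Kt` over `𝔽_p`, indexed by `Fin t`. [folklore] -/
noncomputable def pbasis (ht : t ≠ 0) : Module.Basis (Fin t) (ZMod p) (Kt p t ht) :=
  (AdjoinRoot.powerBasis' (monic_irredPoly p ht)).basis.reindex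
    (finCongr (by rw [AdjoinRoot.powerBasis'_dim, natDegree_irredPoly]))

/-- The coordinate isomorphism `Kt ≃ 𝔽_pᵗ`. [folklore] -/
noncomputable def coordEquiv (ht : t ≠ 0) : Kt p t ht ≃ₗ[ZMod p] (Fin t → ZMod p) := (pbasis p ht).equivFun

/-- `Kt` is finite: enumerated through its coordinates. [folklore] -/
noncomputable instance instFintypeKt (ht : t ≠ 0) : Fintype (Kt p t ht) :=
  Fintype.ofEquiv (Fin t → ZMod p) (coordEquiv p ht).symm.toEquiv

/-- Equality in `Kt` is (classically) decidable. [folklore] -/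
noncomputable instance instDecidableEqKt (ht : t ≠ 0) : DecidableEq (Kt p t ht) := Classical.decEq _

/-- `|Kt| = p^t`. [folklore] -/
theorem card_Kt (ht : t ≠ 0) : Fintype.card (Kt p t ht) = p ^ t := by
  rw [Fintype.ofEquiv_card, Fintype.card_fun, ZMod.card, Fintype.card_fin]

/-- **The index of a field element**: its coefficient vector read as a number `< p^t`. [folklore] -/
noncomputable def elemIdx (ht : t ≠ 0) : Kt p t ht ≃ Fin (p ^ t) :=
  (coordEquiv p ht).toEquiv.trans (vecIdx p t)

/-- **The index of a point of the universe `Kt × Kt`**. [folklore] -/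
noncomputable def univIdx (ht : t ≠ 0) : Kt p t ht × Kt p t ht ≃ Fin (p ^ t * p ^ t) :=
  ((elemIdx p ht).prodCongr (elemIdx p ht)).trans finProdFinEquiv

/-! ### The concrete design -/

/-- The evaluation points: the field elements of index `0, …, N-1` (`N ≤ p^t`). [cite: CarmosinoImpagliazzoKabanetsKolokolova2016, §3.1 ("the first n field elements")] -/
noncomputable def evalPtsC (ht : t ≠ 0) (N : ℕ) (hN : N ≤ p ^ t) : Fin N ↪ Kt p t ht :=
  (Fin.castLEEmb hN).trans (elemIdx p ht).symm.toEmbedding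

/-- **The concrete `AC⁰[p]`-computable NW design**: block `v ∈ {0,1}^ℓ` is the set of indices of the
points `(r_i, A_v(r_i))`, `i < N`, of `Kt × Kt`. [cite: CarmosinoImpagliazzoKabanetsKolokolova2016, Thm. 3.3] -/
noncomputable def designC (ht : t ≠ 0) (N ℓ : ℕ) (hN : N ≤ p ^ t) :
    (Fin ℓ → Bool) → (Fin N ↪ Fin (p ^ t * p ^ t)) :=
  fun v => (design (evalPtsC p ht N hN) ℓ v).trans (univIdx p ht).toEmbedding

/-- Unfolding the concrete design. [folklore] -/
theorem designC_apply (ht : t ≠ 0) {N ℓ : ℕ} (hN : N ≤ p ^ t) (v : Fin ℓ → Bool) (i : Fin N) :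
    designC p ht N ℓ hN v i = univIdx p ht (design (evalPtsC p ht N hN) ℓ v i) := rfl

/-- **Intersections `≤ ℓ`.** [cite: CarmosinoImpagliazzoKabanetsKolokolova2016, Thm. 3.3] -/
theorem isNWDesign_designC (ht : t ≠ 0) (N ℓ : ℕ) (hN : N ≤ p ^ t) : IsNWDesign ℓ (designC p ht N ℓ hN) :=
  (isNWDesign_design (evalPtsC p ht N hN) ℓ).trans (univIdx p ht).toEmbedding

/-- **Every seed coordinate of the concrete design is an `AC⁰[p]` circuit of depth `4`** and size
`coordSize (p^t) t ℓ p`. [cite: CarmosinoImpagliazzoKabanetsKolokolova2016, Thm. 3.7] -/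
theorem acRealOver_designC (ht : t ≠ 0) {N ℓ : ℕ} (hN : N ≤ p ^ t) (z : Fin (p ^ t * p ^ t) → Bool) (i : Fin N) :
    ACRealOver (accBasis p) (fun v : Fin ℓ → Bool => z (designC p ht N ℓ hN v i)) 4
      (coordSize (p ^ t) t ℓ p) := by
  have h := acRealOver_design (ℓ := ℓ) (pbasis p ht) (evalPtsC p ht N hN) (fun x => z (univIdx p ht x)) i
  rw [card_Kt] at h
  exact h.congr fun v => rfl

end GFDesign

end Literature.Computability.MetaComplexity
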